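import Literature.NumberTheory.Automorphic.ArtinLFunctionsRankOnePrimitive
import Literature.NumberTheory.GaloisRepresentations.ArtinLFunctionProofs
import HarnessLib

/-!
# Characters of degree one: the strong primitive datum, sign types of powers, and the signature

Topic `Literature/NumberTheory/Automorphic`; namespace `Literature.NumberTheory.Automorphic`.  Pure-proof
companion of `ArtinLFunctionsRankOnePrimitive.lean`, serving the archimedean matching of
`ArtinRankOneGammaFactorProofs.lean` (the `Γ`-factor of the primitive ray class character of a character of
degree one is the Artin `Γ`-factor) and, through it, Booker's Lemma 1
(`Automorphic.booker_additiveTwist_meromorphic`).  Three groups of results, all proved: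

* `exists_primitive_rayClass_datum'` — the primitive ray class datum `(𝔣, χ, p)` of
  `ψ : Γ_K → GL_1(ℂ)` of `exists_primitive_rayClass_datum` (Neukirch VII (10.6), Remark) **together with
  the Frobenius matching** `χ(𝔭) = ψ(Frob_𝔭)` at every `𝔭 ∤ 𝔣` (where `ψ` is unramified) and the
  ramification of `ψ` at every `𝔭 ∣ 𝔣` — information which the proof in
  `ArtinLFunctionsRankOnePrimitive` establishes (no Euler factor is missing: `𝔣` and the modulus of the
  reciprocity datum have the same prime divisors) but does not export;
* sign types (Neukirch VII (6.9), type `(p, 0)`): if two ray class characters `χ mod 𝔣`, `χ' mod 𝔣'` of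
  sign types `p`, `p'` satisfy `χ'(𝔭) = χ(𝔭)^j` at the primes `𝔭 ∤ 𝔣𝔣'`, then `p' = p` for odd `j` and
  `p' = ∅` for even `j` (`IsSignType.mem_iff_of_apply_eq_pow`, `IsSignType.card_eq_of_apply_eq_pow`);
  in particular the datum of the trivial character has empty sign type;
* the signature (Martinet §3; Neukirch VII §12 p. 536) of a character of degree one at a real place:
  `(1, 0)` or `(0, 1)` according as `ψ(c) = 1` or `ψ(c) = -1` for a complex conjugation `c` at that
  place (`signature_toArtinRep_rankOne`), the exponent form
  `γ(ρ, s) = Γ_ℝ(s)^{Σ n⁺} Γ_ℝ(s+1)^{Σ n⁻} Γ_ℂ(s)^{r₂ dim V}` of the Artin `Γ`-factor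
  (`ArtinRep.gammaFactor_eq_pow_mul_pow_mul_pow`), and the count of "odd" real places of the powers
  `ψ^j` (`card_filter_det_pow_ne_one`).

## References

* J. Neukirch, *Algebraic Number Theory*, Springer 1999, Ch. VII §10 Thm. (10.6) and Remark; §6
  Prop. (6.9); §12 pp. 536–537. [NeukirchANT1999]
* J. Martinet, *Character theory and Artin L-functions*, in: Algebraic Number Fields (Durham 1975),
  Academic Press 1977, §3. [MartinetDurham1977]
-/

noncomputable section

open scoped NumberField
open Field IsDedekindDomain NumberField NumberField.InfinitePlace Filter Complex Module
open Literature.NumberTheory.GaloisRepresentations Literature.NumberTheory.LFunctions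

universe u

/-! ### Sign types of characters agreeing up to a power -/

namespace Literature.NumberTheory.LFunctions

variable {K : Type*} [Field K] [NumberField K]

/-- `χ((a)) = ∏_𝔭 χ(𝔭)^{ν_𝔭(a)}` only involves primes dividing `(a)`; if `a ≡ 1 mod 𝔣` these do not
divide `𝔣`. [folklore] -/
theorem not_le_of_count_ne_zero_of_sub_one_mem {𝔣 : Ideal (𝓞 K)} {a : 𝓞 K} (ha : a ≠ 0)
    (ha1 : a - 1 ∈ 𝔣) {v : HeightOneSpectrum (𝓞 K)}
    (hv : (Associates.mk v.asIdeal).count (Associates.mk (Ideal.span {a})).factors ≠ 0) :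
    ¬ 𝔣 ≤ v.asIdeal := by
  intro hle
  have hI : Ideal.span {a} ≠ ⊥ := by simpa using ha
  have hdvd : v.asIdeal ∣ Ideal.span {a} := (Associates.count_ne_zero_iff_dvd hI v.irreducible).mp hv
  have ha' : a ∈ v.asIdeal := Ideal.le_of_dvd hdvd (Ideal.mem_span_singleton_self a)
  have h1 : (1 : 𝓞 K) ∈ v.asIdeal := by
    have : (1 : 𝓞 K) = a - (a - 1) := by ring
    rw [this]
    exact v.asIdeal.sub_mem ha' (hle ha1)
  exact v.isPrime.ne_top ((Ideal.eq_top_iff_one _).mpr h1)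

/-- If `χ'(𝔭) = χ(𝔭)^j` at every prime dividing `(a)`, `a ≡ 1 mod 𝔣𝔣'`-style, then
`χ'((a)) = χ((a))^j`. [folklore] -/
theorem idealPow_span_eq_pow_of_apply_eq_pow {𝔣 𝔣' : Ideal (𝓞 K)}
    {χ χ' : HeightOneSpectrum (𝓞 K) → ℂ} (j : ℕ)
    (hagree : ∀ v : HeightOneSpectrum (𝓞 K), ¬ 𝔣 ≤ v.asIdeal → ¬ 𝔣' ≤ v.asIdeal → χ' v = χ v ^ j)
    {a : 𝓞 K} (ha : a ≠ 0) (ha1 : a - 1 ∈ 𝔣) (ha1' : a - 1 ∈ 𝔣') :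
    idealPow K χ' (Ideal.span {a}) = idealPow K χ (Ideal.span {a}) ^ j := by
  have hI : Ideal.span {a} ≠ ⊥ := by simpa using ha
  unfold idealPow
  rw [finprod_pow (mulSupport_idealPow_finite χ hI)]
  refine finprod_congr fun v => ?_
  by_cases hc : (Associates.mk v.asIdeal).count (Associates.mk (Ideal.span {a})).factors = 0
  · rw [hc, pow_zero, pow_zero, one_pow]
  · rw [hagree v (not_le_of_count_ne_zero_of_sub_one_mem ha ha1 hc)
      (not_le_of_count_ne_zero_of_sub_one_mem ha ha1' hc), ← pow_mul, ← pow_mul, mul_comm]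

omit [NumberField K] in
open scoped Classical in
/-- The sign character of a single real place: `∏_{w' ∈ p} (w' = w ? -1 : 1) = (w ∈ p ? -1 : 1)`. [folklore] -/
theorem prod_ite_eq_neg_one (p : Finset {w : InfinitePlace K // IsReal w}) (w : {w : InfinitePlace K // IsReal w}) :
    (∏ w' ∈ p, (if w' = w then (-1 : SignType) else 1)) = if w ∈ p then -1 else 1 :=
  Finset.prod_ite_eq' p w fun _ => (-1 : SignType)

/-- **Sign types of characters agreeing up to a power.**  Let `χ mod 𝔣` and `χ' mod 𝔣'` be ray class
characters (values on primes) of sign types `p` and `p'` (Neukirch VII (6.9): `χ((a)) = sgn N(a^p)` for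
`a ≡ 1 mod 𝔣`), and suppose `χ'(𝔭) = χ(𝔭)^j` for all primes `𝔭 ∤ 𝔣𝔣'`.  Then a real place `w` lies in
`p'` iff `j` is odd and `w ∈ p`: test with an integer `a ≡ 1 mod 𝔣𝔣'` negative at `w` and positive at
the other real places (`exists_sub_one_mem_sign_eq`, Neukirch VI (1.9)), for which
`χ'((a)) = χ((a))^j` reads `(-1)^{[w ∈ p']} = (-1)^{j [w ∈ p]}`.
[cite: NeukirchANT1999, Ch. VII §6 Prop. (6.9); Ch. VI §1 Prop. (1.9)] -/
theorem IsSignType.mem_iff_of_apply_eq_pow {𝔣 𝔣' : Ideal (𝓞 K)} {χ χ' : HeightOneSpectrum (𝓞 K) → ℂ}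
    {p p' : Finset {w : InfinitePlace K // IsReal w}} (h𝔣 : 𝔣 ≠ ⊥) (h𝔣' : 𝔣' ≠ ⊥)
    (hp : IsSignType 𝔣 χ p) (hp' : IsSignType 𝔣' χ' p') (j : ℕ)
    (hagree : ∀ v : HeightOneSpectrum (𝓞 K), ¬ 𝔣 ≤ v.asIdeal → ¬ 𝔣' ≤ v.asIdeal → χ' v = χ v ^ j)
    (w : {w : InfinitePlace K // IsReal w}) : w ∈ p' ↔ (Odd j ∧ w ∈ p) := by
  classical
  -- the test integer
  obtain ⟨a, ha0, ha1, hsign⟩ := exists_sub_one_mem_sign_eq (𝔪 := 𝔣 * 𝔣') (mul_ne_zero h𝔣 h𝔣')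
    (fun w' => if w' = w then -1 else 1) (fun w' => by split_ifs <;> decide)
  have ha1f : a - 1 ∈ 𝔣 := Ideal.mul_le_right ha1
  have ha1f' : a - 1 ∈ 𝔣' := Ideal.mul_le_left ha1
  -- signs of `a`
  have hsp : ∀ q : Finset {w : InfinitePlace K // IsReal w},
      SignType.sign (NumberField.realPow K q (a : K)) = if w ∈ q then -1 else 1 := fun q => by
    rw [sign_realPow_eq_prod, ← prod_ite_eq_neg_one q w]
    exact Finset.prod_congr rfl fun w' _ => hsign w'
  -- the two evaluations of `χ'((a))`
  have h1 : idealPow K χ' (Ideal.span {a}) = ((if w ∈ p' then -1 else 1 : SignType) : ℂ) := by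
    rw [hp'.idealPow_span_eq_sign a ha0 ha1f', hsp p']
  have h2 : idealPow K χ' (Ideal.span {a}) = ((if w ∈ p then -1 else 1 : SignType) : ℂ) ^ j := by
    rw [idealPow_span_eq_pow_of_apply_eq_pow j hagree ha0 ha1f ha1f', hp.idealPow_span_eq_sign a ha0 ha1f,
      hsp p]
  have key : ((if w ∈ p' then -1 else 1 : SignType) : ℂ) = ((if w ∈ p then -1 else 1 : SignType) : ℂ) ^ j :=
    h1.symm.trans h2
  have hne : (-1 : ℂ) ≠ 1 := by norm_num
  by_cases hw' : w ∈ p' <;> by_cases hw : w ∈ p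
  · -- `-1 = (-1)^j`: `j` is odd
    simp only [hw', hw, if_true, SignType.coe_neg_one] at key
    refine ⟨fun _ => ⟨?_, hw⟩, fun _ => hw'⟩
    by_contra hj
    rw [Nat.not_odd_iff_even] at hj
    rw [hj.neg_one_pow] at key
    exact hne key
  · -- `-1 = 1^j`: impossible
    simp only [hw', hw, if_true, if_false, SignType.coe_neg_one, SignType.coe_one, one_pow] at key
    exact absurd key hne
  · -- `1 = (-1)^j`: `j` is even
    simp only [hw', hw, if_true, if_false, SignType.coe_neg_one, SignType.coe_one] at key
    refine ⟨fun h => absurd h hw', fun ⟨hj, _⟩ => ?_⟩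
    rw [hj.neg_one_pow] at key
    exact absurd key.symm hne
  · exact ⟨fun h => absurd h hw', fun ⟨_, h⟩ => absurd h hw⟩

/-- **Corollary: the size of the sign type of `χ^j`** — `|p'| = |p|` for odd `j`, `0` for even `j`.
[cite: NeukirchANT1999, Ch. VII §6 Prop. (6.9)] -/
theorem IsSignType.card_eq_of_apply_eq_pow {𝔣 𝔣' : Ideal (𝓞 K)} {χ χ' : HeightOneSpectrum (𝓞 K) → ℂ}
    {p p' : Finset {w : InfinitePlace K // IsReal w}} (h𝔣 : 𝔣 ≠ ⊥) (h𝔣' : 𝔣' ≠ ⊥)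
    (hp : IsSignType 𝔣 χ p) (hp' : IsSignType 𝔣' χ' p') (j : ℕ)
    (hagree : ∀ v : HeightOneSpectrum (𝓞 K), ¬ 𝔣 ≤ v.asIdeal → ¬ 𝔣' ≤ v.asIdeal → χ' v = χ v ^ j) :
    p'.card = if Odd j then p.card else 0 := by
  have hmem := hp.mem_iff_of_apply_eq_pow h𝔣 h𝔣' hp' j hagree
  split_ifs with hj
  · congr 1
    ext w
    rw [hmem w]
    exact ⟨fun h => h.2, fun h => ⟨hj, h⟩⟩
  · rw [Finset.card_eq_zero, Finset.eq_empty_iff_forall_notMem]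
    intro w hw
    exact hj ((hmem w).mp hw).1

/-- **The trivial character has empty sign type**: if `χ(𝔭) = 1` for all `𝔭 ∤ 𝔣` then `p = ∅`.
[cite: NeukirchANT1999, Ch. VII §6 Prop. (6.9)] -/
theorem IsSignType.eq_empty_of_apply_eq_one {𝔣 : Ideal (𝓞 K)} {χ : HeightOneSpectrum (𝓞 K) → ℂ}
    {p : Finset {w : InfinitePlace K // IsReal w}} (h𝔣 : 𝔣 ≠ ⊥) (hp : IsSignType 𝔣 χ p)
    (h1 : ∀ v : HeightOneSpectrum (𝓞 K), ¬ 𝔣 ≤ v.asIdeal → χ v = 1) : p = ∅ := by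
  have h := hp.card_eq_of_apply_eq_pow h𝔣 h𝔣 hp 0 (fun v hv _ => by rw [pow_zero, h1 v hv])
  simp only [Nat.not_odd_zero, if_false, Finset.card_eq_zero] at h
  exact h

end Literature.NumberTheory.LFunctions

namespace Literature.NumberTheory.Automorphic

variable {K : Type u} [Field K] [NumberField K]

/-! ### The strong primitive datum of a character of degree one -/

/-- **The primitive ray class datum of a character of degree one, with its Frobenius matching**
(Neukirch VII (10.6) and Remark: "one has complete equality `𝓛(L|K, χ, s) = L(χ̃, s)` … `χ̃` is a
primitive Größencharakter `mod 𝔣`", `χ̃(𝔭) = χ(φ_𝔭)` for `𝔭 ∤ 𝔣`, and `𝔣` is divisible exactly by the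
ramified primes, VI (6.6)).  For every `ψ : Γ_K → GL_1(ℂ)` there are `𝔣 ≠ 0`, a primitive ray class
character `χ mod 𝔣` of sign type `p`, such that: at every `𝔭 ∤ 𝔣` the character `ψ` is unramified and
`χ(𝔭) = ψ(Frob_𝔭)`; at every `𝔭 ∣ 𝔣` it is ramified; and `L(s, ψ) = L(χ, s)`, `L(s, ψ^∨) = L(χ̄, s)` on
`re s > 1`.  Proof: that of `exists_primitive_rayClass_datum` verbatim (the reciprocity datum
`(𝔪, χ̃)` of `artinReciprocity_rankOne_holds` replaced by its primitive associate `(𝔣, χ₀)`,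
`transportChar`; the analytic argument shows that every prime of `𝔪` divides `𝔣`), keeping the
by-products: `𝔪` and `𝔣 ∣ 𝔪` then have the same prime divisors, so the Frobenius matching and the
ramification statement of the reciprocity datum transfer to `𝔣`, and `χ₀ = χ̃` off `𝔪`
(`transportChar_eq`).
[cite: NeukirchANT1999, Ch. VII §10 Thm. (10.6) (Remark); Ch. VII §6 p. 472; Ch. VI §6 Cor. (6.6)] -/
theorem exists_primitive_rayClass_datum' (ψ : FramedArtinRep K 1) :
    ∃ (𝔣 : Ideal (𝓞 K)) (χ : HeightOneSpectrum (𝓞 K) → ℂ) (p : Finset {w : InfinitePlace K // w.IsReal}),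
      𝔣 ≠ ⊥ ∧ IsRayClassCharacter 𝔣 χ ∧ IsPrimitive 𝔣 χ ∧ IsSignType 𝔣 χ p ∧
      (∀ v : HeightOneSpectrum (𝓞 K), ¬ 𝔣 ≤ v.asIdeal →
        GaloisRep.IsUnramifiedAt v ψ.toArtinRep ∧
          ∀ 𝔓 ∈ v.primesAbove, ∀ σ : absoluteGaloisGroup K, IsArithFrobAt (𝓞 K) σ 𝔓 →
            χ v = (FramedRep.det ψ σ : ℂ)) ∧
      (∀ v : HeightOneSpectrum (𝓞 K), 𝔣 ≤ v.asIdeal → ¬ GaloisRep.IsUnramifiedAt v ψ.toArtinRep) ∧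
      (∀ s : ℂ, 1 < s.re → artinLFunction ψ.toArtinRep s = rayClassLSeries 𝔣 χ s) ∧
      (∀ s : ℂ, 1 < s.re →
        artinLFunction (FramedArtinRep.toArtinRep (FramedRep.dual ψ)) s = rayClassLSeries 𝔣 (star χ) s) := by
  classical
  -- the reciprocity datum `(𝔪, χ̃)` and its dual
  obtain ⟨𝔪, h𝔪, χ, hχ, hunr, hram⟩ := artinReciprocity_rankOne_holds K ψ
  have hL : ∀ s : ℂ, 1 < s.re → artinLFunction ψ.toArtinRep s = rayClassLSeries 𝔪 χ s := fun s hs ↦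
    artinLFunction_eq_rayClassLSeries ψ h𝔪 hχ hunr hram hs
  have hunr' : ∀ v : HeightOneSpectrum (𝓞 K), ¬ 𝔪 ≤ v.asIdeal →
      GaloisRep.IsUnramifiedAt v (FramedArtinRep.toArtinRep (FramedRep.dual ψ)) ∧
        ∀ 𝔓 ∈ v.primesAbove, ∀ σ : absoluteGaloisGroup K, IsArithFrobAt (𝓞 K) σ 𝔓 →
          (star χ) v = (FramedRep.det (FramedRep.dual ψ) σ : ℂ) := by
    intro v hv
    obtain ⟨hur, hval⟩ := hunr v hv
    refine ⟨(FramedGaloisRep.isUnramifiedAt_toGaloisRep_iff v _).mpr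
      ((FramedGaloisRep.isUnramifiedAt_dual_iff v ψ).mpr ((FramedGaloisRep.isUnramifiedAt_toGaloisRep_iff v ψ).mp hur)),
      fun 𝔓 h𝔓 σ hσ ↦ ?_⟩
    have h1 : ‖χ v‖ = 1 := hχ.norm_eq_one v hv
    rw [Pi.star_apply, det_dual_apply, Units.val_inv_eq_inv_val, ← hval 𝔓 h𝔓 σ hσ, Complex.inv_eq_conj h1]
    rfl
  have hram' : ∀ v : HeightOneSpectrum (𝓞 K), 𝔪 ≤ v.asIdeal →
      ¬ GaloisRep.IsUnramifiedAt v (FramedArtinRep.toArtinRep (FramedRep.dual ψ)) := fun v hv h ↦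
    hram v hv ((FramedGaloisRep.isUnramifiedAt_toGaloisRep_iff v ψ).mpr
      ((FramedGaloisRep.isUnramifiedAt_dual_iff v ψ).mp ((FramedGaloisRep.isUnramifiedAt_toGaloisRep_iff v _).mp h)))
  have hL' : ∀ s : ℂ, 1 < s.re →
      artinLFunction (FramedArtinRep.toArtinRep (FramedRep.dual ψ)) s = rayClassLSeries 𝔪 (star χ) s := fun s hs ↦
    artinLFunction_eq_rayClassLSeries (FramedRep.dual ψ) h𝔪 hχ.star hunr' hram' hs
  -- the primitive associate `(𝔣, χ₀)` of `(𝔪, χ̃)`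
  obtain ⟨p, hp⟩ := hχ.exists_isSignType h𝔪
  obtain ⟨𝔣, hD, hmax⟩ := exists_conductor hp h𝔪
  obtain ⟨𝔟, h𝔟⟩ := exists_isTransportData h𝔪 hD.le
  set χ₀ := transportChar K χ 𝔣 𝔟 with hχ₀
  have h𝔣0 : 𝔣 ≠ ⊥ := fun h ↦ h𝔪 (le_bot_iff.mp (h ▸ hD.le))
  have hχ₀ : IsRayClassCharacter 𝔣 χ₀ := isRayClassCharacter_transportChar hχ hp h𝔪 hD h𝔟
  have hprim : IsPrimitive 𝔣 χ₀ := isPrimitive_transportChar hχ hp h𝔪 hD hmax h𝔟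
  have hsign : IsSignType 𝔣 χ₀ p := isSignType_transportChar hχ hp h𝔪 hD h𝔟
  set T : Finset (HeightOneSpectrum (𝓞 K)) :=
    (Ideal.finite_factors h𝔪).toFinset.filter (fun v ↦ ¬ 𝔣 ≤ v.asIdeal) with hT
  have hmemT : ∀ v, v ∈ T ↔ 𝔪 ≤ v.asIdeal ∧ ¬ 𝔣 ≤ v.asIdeal := fun v ↦ by
    rw [hT, Finset.mem_filter, Set.Finite.mem_toFinset, Set.mem_setOf_eq, Ideal.dvd_iff_le]
  set P : ℂ → ℂ := fun s ↦ ∏ v ∈ T, (1 - χ₀ v * ((Ideal.absNorm v.asIdeal : ℕ) : ℂ) ^ (-s)) with hPdef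
  have hE : ∀ s : ℂ, 1 < s.re → rayClassLSeries 𝔪 χ s = rayClassLSeries 𝔣 χ₀ s * P s := fun s hs ↦
    rayClassLSeries_eq_mul_prod_transportChar hχ hp h𝔪 hD h𝔟 hs
  have hE' : ∀ s : ℂ, 1 < s.re → rayClassLSeries 𝔪 (star χ) s = rayClassLSeries 𝔣 (star χ₀) s *
      ∏ v ∈ T, (1 - (star χ₀) v * ((Ideal.absNorm v.asIdeal : ℕ) : ℂ) ^ (-s)) := fun s hs ↦ by
    have := rayClassLSeries_eq_mul_prod_transportChar hχ.star hp.star h𝔪 hD.star h𝔟 hs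
    rwa [transportChar_star] at this
  -- it suffices that no Euler factor is missing
  suffices hTe : T = ∅ by
    have hsupp : ∀ v : HeightOneSpectrum (𝓞 K), 𝔪 ≤ v.asIdeal → 𝔣 ≤ v.asIdeal := fun v hv ↦ by
      by_contra hf
      have : v ∈ T := (hmemT v).mpr ⟨hv, hf⟩
      rw [hTe] at this
      exact Finset.notMem_empty v this
    refine ⟨𝔣, χ₀, p, h𝔣0, hχ₀, hprim, hsign, fun v hv ↦ ?_, fun v hv ↦ hram v (hD.le.trans hv),
      fun s hs ↦ ?_, fun s hs ↦ ?_⟩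
    · have hv' : ¬ 𝔪 ≤ v.asIdeal := fun h ↦ hv (hsupp v h)
      obtain ⟨hur, hval⟩ := hunr v hv'
      refine ⟨hur, fun 𝔓 h𝔓 σ hσ ↦ ?_⟩
      have hvv : χ₀ v = χ v := transportChar_eq hχ hp h𝔪 hD h𝔟 hv'
      rw [hvv]
      exact hval 𝔓 h𝔓 σ hσ
    · rw [hL s hs, hE s hs, hPdef]
      simp only [hTe, Finset.prod_empty, mul_one]
    · rw [hL' s hs, hE' s hs, hTe, Finset.prod_empty, mul_one]
  by_contra hne
  obtain ⟨v₀, hv₀⟩ := Finset.nonempty_iff_ne_empty.mpr hne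
  obtain ⟨hv₀m, hv₀f⟩ := (hmemT v₀).mp hv₀
  -- (1) `ψ` is non-trivial (it ramifies at `v₀ ∣ 𝔪`)
  have hψnt : ∃ γ, FramedRep.det ψ γ ≠ 1 := by
    by_contra hall
    push Not at hall
    exact hram v₀ hv₀m ((FramedGaloisRep.isUnramifiedAt_toGaloisRep_iff v₀ ψ).mpr
      fun 𝔓 _ σ _ ↦ (det_eq_one_iff_rankOne ψ σ).mp (hall σ))
  -- (2) `P` is entire
  have hPd : Differentiable ℂ P := by
    have hq : ∀ v : HeightOneSpectrum (𝓞 K), ((Ideal.absNorm v.asIdeal : ℕ) : ℂ) ≠ 0 := fun v ↦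
      Nat.cast_ne_zero.mpr (by have := HeightOneSpectrum.one_lt_absNorm v; omega)
    refine Differentiable.fun_finsetProd fun v _ ↦ ?_
    exact (differentiable_const _).fun_sub ((differentiable_const _).fun_mul
      (differentiable_id.fun_neg.const_cpow (Or.inl (hq v))))
  -- (3) continuations: `G` of `L(χ₀, s)`, `F j` of `L(s, ψ^j)`, and `ζ_M = ∏ F j`
  obtain ⟨G, -, hGd, hGs⟩ := rayClassLSeries_hasMeromorphicContinuation_holds (K := K) 𝔣 h𝔣0 χ₀ hχ₀
  obtain ⟨Ψ, hΨ1, -, M, _, _, n, h1n, hζ⟩ := exists_dedekindZeta_eq_prod_artinLFunction_pow ψ hψnt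
  have hF := fun j : ℕ ↦ exists_differentiableOn_eq_artinLFunction_rankOne (Ψ j)
  choose F hFd hFs using hF
  -- (4) the identity theorem, twice
  have hU : ({0, 1}ᶜ : Set ℂ) ⊆ ({1}ᶜ : Set ℂ) := Set.compl_subset_compl.mpr (Set.subset_insert _ _)
  have hζd : DifferentiableOn ℂ (dedekindZetaCont M) ({0, 1}ᶜ : Set ℂ) :=
    (NumberField.isDedekindZetaContinuation_dedekindZetaCont_holds M).differentiableOn.mono hU
  have hprod : Set.EqOn (dedekindZetaCont M) (fun s ↦ ∏ j ∈ Finset.range n, F j s) ({0, 1}ᶜ : Set ℂ) := by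
    refine eqOn_compl_zero_one_of_eqOn_one_lt_re hζd (DifferentiableOn.fun_finsetProd fun j _ ↦ hFd j) fun s hs ↦ ?_
    rw [(NumberField.isDedekindZetaContinuation_dedekindZetaCont_holds M).eqOn hs, hζ s hs]
    exact Finset.prod_congr rfl fun j _ ↦ (hFs j s hs).symm
  have hone : Set.EqOn (F 1) (G * P) ({0, 1}ᶜ : Set ℂ) := by
    refine eqOn_compl_zero_one_of_eqOn_one_lt_re (hFd 1) (hGd.mul hPd.differentiableOn) fun s hs ↦ ?_
    rw [hFs 1 s hs, hΨ1, hL s hs, hE s hs, Pi.mul_apply, hGs s hs]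
  -- (5) the zero `s₀ = it₀` of the missing Euler factor at `v₀`
  obtain ⟨s₀, hre, him, hv₀0⟩ := exists_one_sub_mul_cpow_neg_eq_zero (hχ₀.norm_eq_one v₀ hv₀f)
    (HeightOneSpectrum.one_lt_absNorm v₀)
  have hs₀U : s₀ ∈ ({0, 1}ᶜ : Set ℂ) := by
    simp only [Set.mem_compl_iff, Set.mem_insert_iff, Set.mem_singleton_iff, not_or]
    exact ⟨fun h ↦ him (by rw [h]; simp), fun h ↦ him (by rw [h]; simp)⟩
  have hP0 : P s₀ = 0 := Finset.prod_eq_zero hv₀ hv₀0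
  -- (6) `ζ_M(s₀) = 0`: contradiction
  have hζ0 : dedekindZetaCont M s₀ = 0 := by
    rw [hprod hs₀U]
    show ∏ j ∈ Finset.range n, F j s₀ = 0
    refine Finset.prod_eq_zero (Finset.mem_range.mpr h1n) ?_
    rw [hone hs₀U, Pi.mul_apply, hP0, mul_zero]
  exact dedekindZetaCont_ne_zero_of_re_eq_zero M hre him hζ0

/-! ### Characters of degree one at a complex conjugation -/

omit [NumberField K] in
/-- A character of degree one acts on `ℂ¹` through the scalar `det ψ(γ) = ψ(γ)₀₀`. [folklore] -/
theorem toArtinRep_apply_rankOne (ψ : FramedArtinRep K 1) (γ : absoluteGaloisGroup K) :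
    (ψ.toArtinRep γ : (Fin 1 → ℂ) →ₗ[ℂ] (Fin 1 → ℂ)) = ((FramedRep.det ψ γ : ℂˣ) : ℂ) • LinearMap.id := by
  have h : (ψ.toArtinRep γ : (Fin 1 → ℂ) →ₗ[ℂ] (Fin 1 → ℂ)) =
      Matrix.toLin' ((ψ γ : GL (Fin 1) ℂ) : Matrix (Fin 1) (Fin 1) ℂ) := by
    refine LinearMap.ext fun v => ?_
    rw [Matrix.toLin'_apply]
    rfl
  rw [h]
  refine LinearMap.ext fun v => funext fun i => ?_
  rw [Matrix.toLin'_apply, LinearMap.smul_apply, LinearMap.id_apply, Pi.smul_apply, smul_eq_mul,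
    Matrix.mulVec, dotProduct, Fin.sum_univ_one, FramedRep.det_apply, Matrix.GeneralLinearGroup.val_det_apply,
    Matrix.det_fin_one, Subsingleton.elim i 0, Subsingleton.elim (0 : Fin 1) 0]

omit [NumberField K] in
/-- `det ψ(c) = ±1` at an involution `c` (`c² = 1`). [folklore] -/
theorem det_eq_one_or_eq_neg_one_of_sq_eq_one {n : ℕ} (ψ : FramedArtinRep K n) {c : absoluteGaloisGroup K}
    (hc : c ^ 2 = 1) : ((FramedRep.det ψ c : ℂˣ) : ℂ) = 1 ∨ ((FramedRep.det ψ c : ℂˣ) : ℂ) = -1 := by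
  have h : ((FramedRep.det ψ c : ℂˣ) : ℂ) * ((FramedRep.det ψ c : ℂˣ) : ℂ) = 1 := by
    rw [← Units.val_mul, ← map_mul, ← pow_two, hc, map_one, Units.val_one]
  exact mul_self_eq_one_iff.mp h

omit [NumberField K] in
/-- **The signature of a character of degree one** (Neukirch VII §12, p. 536: the eigenspace
decomposition `V = V⁺ ⊕ V⁻` of the involution `φ_𝔓`; here `V = ℂ¹` and `φ_𝔓 = c`): at the real
embedding `φ`, with `c` any complex conjugation attached to `φ`, the signature `(n⁺, n⁻)` of `ψ` is
`(1, 0)` if `ψ(c) = 1` and `(0, 1)` if `ψ(c) = -1`.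
[cite: NeukirchANT1999, Ch. VII §12, p. 536] [cite: MartinetDurham1977, §3] -/
theorem signature_toArtinRep_rankOne (ψ : FramedArtinRep K 1) {φ : K →+* ℝ} {c : absoluteGaloisGroup K}
    (hc : IsComplexConjugation φ c) :
    ψ.toArtinRep.signature φ = if ((FramedRep.det ψ c : ℂˣ) : ℂ) = 1 then (1, 0) else (0, 1) := by
  rw [ArtinRep.signature_eq_holds ψ.toArtinRep hc]
  have happ : (ψ.toArtinRep c : (Fin 1 → ℂ) →ₗ[ℂ] (Fin 1 → ℂ)) =
      ((FramedRep.det ψ c : ℂˣ) : ℂ) • LinearMap.id := toArtinRep_apply_rankOne ψ c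
  have hu2 := det_eq_one_or_eq_neg_one_of_sq_eq_one ψ hc.sq_eq_one
  set u : ℂ := ((FramedRep.det ψ c : ℂˣ) : ℂ) with hu
  -- eigenspaces of a scalar
  have heig : ∀ μ : ℂ, Module.End.eigenspace (ψ.toArtinRep c : (Fin 1 → ℂ) →ₗ[ℂ] (Fin 1 → ℂ)) μ =
      if u = μ then ⊤ else ⊥ := by
    intro μ
    ext v
    rw [Module.End.mem_eigenspace_iff, happ, LinearMap.smul_apply, LinearMap.id_apply]
    split_ifs with h
    · simp only [h, Submodule.mem_top]
    · simp only [Submodule.mem_bot]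
      constructor
      · intro hv
        have h0 : (u - μ) • v = 0 := by rw [sub_smul, hv, sub_self]
        exact (smul_eq_zero.mp h0).resolve_left (sub_ne_zero.mpr h)
      · intro hv
        rw [hv, smul_zero, smul_zero]
  have hfin1 : finrank ℂ (⊤ : Submodule ℂ (Fin 1 → ℂ)) = 1 := by
    rw [finrank_top, Module.finrank_fin_fun]
  have hfin0 : finrank ℂ (⊥ : Submodule ℂ (Fin 1 → ℂ)) = 0 := finrank_bot ℂ (Fin 1 → ℂ)
  rcases hu2 with h1 | h1
  · have h2 : ¬ u = -1 := by rw [h1]; norm_num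
    rw [if_pos h1, heig, heig, if_pos h1, if_neg h2, hfin1, hfin0]
  · have h2 : ¬ u = 1 := by rw [h1]; norm_num
    rw [if_neg h2, heig, heig, if_neg h2, if_pos h1, hfin1, hfin0]

omit [NumberField K] in
/-- The second signature entry of a character of degree one is `0` or `1` according as `ψ(c) = 1` or
not, for any complex conjugation `c` at the place. [cite: NeukirchANT1999, Ch. VII §12, p. 536] -/
theorem signature_snd_toArtinRep_rankOne (ψ : FramedArtinRep K 1) {φ : K →+* ℝ} {c : absoluteGaloisGroup K}
    (hc : IsComplexConjugation φ c) :
    (ψ.toArtinRep.signature φ).2 = if ((FramedRep.det ψ c : ℂˣ) : ℂ) = 1 then 0 else 1 := by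
  rw [signature_toArtinRep_rankOne ψ hc]
  split_ifs <;> rfl

omit [NumberField K] in
/-- The first signature entry of a character of degree one is `1` or `0` according as `ψ(c) = 1` or
not. [cite: NeukirchANT1999, Ch. VII §12, p. 536] -/
theorem signature_fst_toArtinRep_rankOne (ψ : FramedArtinRep K 1) {φ : K →+* ℝ} {c : absoluteGaloisGroup K}
    (hc : IsComplexConjugation φ c) :
    (ψ.toArtinRep.signature φ).1 = if ((FramedRep.det ψ c : ℂˣ) : ℂ) = 1 then 1 else 0 := by
  rw [signature_toArtinRep_rankOne ψ hc]
  split_ifs <;> rfl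

/-! ### The Artin `Γ`-factor in exponent form -/

open scoped Classical in
/-- **Exponent form of the Artin `Γ`-factor**:
`γ(ρ, s) = Γ_ℝ(s)^{Σ_{w real} n⁺_w} Γ_ℝ(s+1)^{Σ_{w real} n⁻_w} Γ_ℂ(s)^{r₂ · dim V}`.
[cite: MartinetDurham1977, §3] -/
theorem _root_.Literature.NumberTheory.GaloisRepresentations.ArtinRep.gammaFactor_eq_pow_mul_pow_mul_pow
    {V : Type*} [AddCommGroup V] [Module ℂ V] [TopologicalSpace V] (ρ : ArtinRep K V) (s : ℂ) :
    ρ.gammaFactor s =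
      Gammaℝ s ^ (∑ w : {w : InfinitePlace K // IsReal w}, (ρ.signature (embedding_of_isReal w.2)).1) *
        Gammaℝ (s + 1) ^ (∑ w : {w : InfinitePlace K // IsReal w}, (ρ.signature (embedding_of_isReal w.2)).2) *
        Gammaℂ s ^ (nrComplexPlaces K * finrank ℂ V) := by
  classical
  rw [ArtinRep.gammaFactor, ← Fintype.prod_subtype_mul_prod_subtype (fun w : InfinitePlace K => IsReal w)]
  congr 1
  · rw [← Finset.prod_pow_eq_pow_sum, ← Finset.prod_pow_eq_pow_sum, ← Finset.prod_mul_distrib]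
    refine Finset.prod_congr rfl fun w _ => ?_
    rw [dif_pos w.2]
  · rw [Finset.prod_congr rfl (fun (w : {w : InfinitePlace K // ¬ IsReal w}) _ => dif_neg w.2),
      Finset.prod_const, Finset.card_univ, ← pow_mul, mul_comm]
    congr 2
    exact Fintype.card_congr (Equiv.subtypeEquivRight fun w => not_isReal_iff_isComplex)

/-! ### Counting the odd real places of a character of degree one and of its powers -/

open scoped Classical in
/-- **The number `n⁻(ψ) = #{w real : ψ(c_w) = -1}` via the signature**: with a complex conjugation
`c w` chosen at each real place, `Σ_{w real} n⁻_w(ψ) = #{w : det ψ(c_w) ≠ 1}`.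
[cite: NeukirchANT1999, Ch. VII §12, p. 536] -/
theorem sum_signature_snd_rankOne (ψ : FramedArtinRep K 1)
    (c : {w : InfinitePlace K // IsReal w} → absoluteGaloisGroup K)
    (hc : ∀ w, IsComplexConjugation (embedding_of_isReal w.2) (c w)) :
    (∑ w : {w : InfinitePlace K // IsReal w}, (ψ.toArtinRep.signature (embedding_of_isReal w.2)).2) =
      (Finset.univ.filter fun w => ((FramedRep.det ψ (c w) : ℂˣ) : ℂ) ≠ 1).card := by
  classical
  rw [Finset.card_filter]
  refine Finset.sum_congr rfl fun w _ => ?_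
  rw [signature_snd_toArtinRep_rankOne ψ (hc w)]
  by_cases h : ((FramedRep.det ψ (c w) : ℂˣ) : ℂ) = 1
  · rw [if_pos h, if_neg (not_not.mpr h)]
  · rw [if_neg h, if_pos h]

open scoped Classical in
/-- `Σ n⁺ + Σ n⁻ = r₁` for a character of degree one. [cite: MartinetDurham1977, §3] -/
theorem sum_signature_fst_add_snd_rankOne (ψ : FramedArtinRep K 1) :
    (∑ w : {w : InfinitePlace K // IsReal w}, (ψ.toArtinRep.signature (embedding_of_isReal w.2)).1) +
      (∑ w : {w : InfinitePlace K // IsReal w}, (ψ.toArtinRep.signature (embedding_of_isReal w.2)).2) =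
      nrRealPlaces K := by
  rw [← Finset.sum_add_distrib]
  have : ∀ w : {w : InfinitePlace K // IsReal w},
      (ψ.toArtinRep.signature (embedding_of_isReal w.2)).1 + (ψ.toArtinRep.signature (embedding_of_isReal w.2)).2 = 1 :=
    fun w => by rw [ArtinRep.signature_fst_add_snd_holds, Module.finrank_fin_fun]
  rw [Finset.sum_congr rfl (fun w _ => this w), Finset.sum_const, smul_eq_mul, mul_one, Finset.card_univ]

open scoped Classical in
/-- **Odd real places of the powers `ψ^j`.**  If `det Ψ(γ) = det ψ(γ)^j` for all `γ`, then the number of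
real places `w` with `Ψ(c_w) ≠ 1` is that of `ψ` for odd `j` and `0` for even `j` (`ψ(c_w) = ±1`).
[cite: NeukirchANT1999, Ch. VII §12, p. 536] -/
theorem card_filter_det_pow_ne_one (ψ Ψ : FramedArtinRep K 1) (j : ℕ)
    (hΨ : ∀ γ, FramedRep.det Ψ γ = FramedRep.det ψ γ ^ j)
    (c : {w : InfinitePlace K // IsReal w} → absoluteGaloisGroup K)
    (hc : ∀ w, IsComplexConjugation (embedding_of_isReal w.2) (c w)) :
    (Finset.univ.filter fun w => ((FramedRep.det Ψ (c w) : ℂˣ) : ℂ) ≠ 1).card =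
      if Odd j then (Finset.univ.filter fun w => ((FramedRep.det ψ (c w) : ℂˣ) : ℂ) ≠ 1).card else 0 := by
  classical
  have hval : ∀ w, ((FramedRep.det Ψ (c w) : ℂˣ) : ℂ) = ((FramedRep.det ψ (c w) : ℂˣ) : ℂ) ^ j := fun w => by
    rw [hΨ, Units.val_pow_eq_pow_val]
  split_ifs with hj
  · congr 1
    ext w
    simp only [Finset.mem_filter, Finset.mem_univ, true_and, hval]
    rcases det_eq_one_or_eq_neg_one_of_sq_eq_one ψ (hc w).sq_eq_one with h | h
    · rw [h, one_pow]
    · rw [h, hj.neg_one_pow]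
  · rw [Finset.card_eq_zero, Finset.filter_eq_empty_iff]
    intro w _
    rw [not_not, hval]
    rw [Nat.not_odd_iff_even] at hj
    rcases det_eq_one_or_eq_neg_one_of_sq_eq_one ψ (hc w).sq_eq_one with h | h
    · rw [h, one_pow]
    · rw [h, hj.neg_one_pow]

end Literature.NumberTheory.Automorphic

end
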